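import Summits.NavierStokesRegularity.NavierStokesRegularity.Theorems.StrainDoorsNearFieldDefs
import Literature.Analysis.FluidPDE.PressurePoisson
import Literature.Analysis.FluidPDE.RapidDecayLemmas
import Literature.Analysis.FluidPDE.LerayProfileCalculus
import Literature.Analysis.FluidPDE.TaoEnstrophyLocalisationProofs
import HarnessLib

/-!
# StrainDoorsPressureSource — `q = Δp` at EVERY time of the half-open slab, route-independently

For a classical unforced Navier–Stokes solution on `[0,T) × ℝ³` (the S33 frame) and every `t ∈ [0,T)` — the initial time
included, by continuity within `[0,T)` — the pressure source of the near-field doors is the Laplacian of the pressure: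
`qDensity u t = Δ (p t)` (`qDensity = ½|ω|² − |S|²_F = |ω|² − |∇u|²_F`).  Interior times: the tree's pressure Poisson
equation (`laplacian_pressure_eq_of_isClassicalNSSolutionOn`, `divergence_convect_self_eq`,
`frobeniusNormSq_fderiv_eq_sq_norm_curl_add_trace`); `t = 0`: both sides are time lines of jointly smooth fields
(`IsSmoothSpaceTimeOn.continuousWithinAt_time`).  Same content as `Theorems.laplacian_pressure_eq_of_mem_Ico`
(`BernoulliDecelerationHeadMaxPointLemma`, which imports a route file) in the door currency and WITHOUT the theses-cone
import, so that `StrainDoorsLocalNewton` can be re-pointed here.  `--supports stmt-NavierStokesRegularity-0056 --as helper`.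
HONEST FRAME: calculus bookkeeping; 0056 `NoTypeII` / NS regularity NOT proved.
-/

noncomputable section

open MeasureTheory Set Function Filter Metric Real InnerProductSpace
open _root_.Topology
open scoped ENNReal NNReal RealInnerProductSpace ContDiff Laplacian
open Literature.Analysis Literature.Analysis.FluidPDE

set_option linter.dupNamespace false

namespace Summit.NavierStokesRegularity.NavierStokesRegularity.Theorems.StrainDoors

/-- `qDensity = |ω|² − |∇u|²_F` (unfolding `strainNormSq`). -/
theorem qDensity_eq_norm_curl_sq_sub (u : ℝ → (EuclideanSpace ℝ (Fin 3)) → (EuclideanSpace ℝ (Fin 3))) (t : ℝ)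
    (x : EuclideanSpace ℝ (Fin 3)) :
    qDensity u t x = ‖curl (u t) x‖ ^ 2 - frobeniusNormSq (fderiv ℝ (u t) x) := by
  unfold qDensity strainNormSq
  ring

/-- **`q = Δp` at interior times**: for `t ∈ (0,T)`, `qDensity u t x = Δ (p t) x`. -/
theorem qDensity_eq_laplacian_pressure_of_mem_Ioo {ν T : ℝ}
    {u : ℝ → (EuclideanSpace ℝ (Fin 3)) → (EuclideanSpace ℝ (Fin 3))} {p : ℝ → (EuclideanSpace ℝ (Fin 3)) → ℝ}
    (hsol : IsClassicalNSSolutionOn (Ico 0 T) ν 0 u p) {t : ℝ} (ht : t ∈ Ioo 0 T) (x : EuclideanSpace ℝ (Fin 3)) :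
    qDensity u t x = Δ (p t) x := by
  have hti : t ∈ interior (Ico (0 : ℝ) T) := by
    rw [interior_Ico]; exact ht
  have htc : t ∈ Ico (0 : ℝ) T := Ioo_subset_Ico_self ht
  have h1 := laplacian_pressure_eq_of_isClassicalNSSolutionOn hsol hti x
  have hu2 : ContDiff ℝ 2 (u t) := (hsol.contDiff_velocity htc).of_le (by norm_cast)
  have h0 : VectorCalculus.divergence ((0 : ℝ → (EuclideanSpace ℝ (Fin 3)) → (EuclideanSpace ℝ (Fin 3))) t) x = 0 := by
    simp [VectorCalculus.divergence, Pi.zero_def]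
  rw [qDensity_eq_norm_curl_sq_sub, h1, h0, add_zero, divergence_convect_self_eq hu2 (hsol.divFree t htc),
    frobeniusNormSq_fderiv_eq_sq_norm_curl_add_trace]
  ring

/-- **`q = Δp` at EVERY time of `[0,T)`** (the initial time by continuity within `[0,T)`). -/
theorem qDensity_eq_laplacian_pressure {ν T : ℝ}
    {u : ℝ → (EuclideanSpace ℝ (Fin 3)) → (EuclideanSpace ℝ (Fin 3))} {p : ℝ → (EuclideanSpace ℝ (Fin 3)) → ℝ}
    (hsol : IsClassicalNSSolutionOn (Ico 0 T) ν 0 u p) {t : ℝ} (ht : t ∈ Ico 0 T) (x : EuclideanSpace ℝ (Fin 3)) :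
    qDensity u t x = Δ (p t) x := by
  have hS : UniqueDiffOn ℝ (Ico (0 : ℝ) T) := uniqueDiffOn_Ico 0 T
  -- the defect `G s = q(s,x) − Δp(s,x)` is continuous within `[0,T)` at `t` and vanishes on `(0,T)`
  set G : ℝ → ℝ := fun s => qDensity u s x - Δ (p s) x with hG
  have hΔc : ContinuousWithinAt (fun s => (Δ (p s)) x) (Ico 0 T) t :=
    (hsol.smooth_pressure.laplacian hS).continuousWithinAt_time ht x
  have hDc : ContinuousWithinAt (fun s => fderiv ℝ (u s) x) (Ico 0 T) t :=
    (hsol.smooth_velocity.fderiv_slice hS).continuousWithinAt_time ht x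
  have hcurlc : ContinuousWithinAt (fun s => curl (u s) x) (Ico 0 T) t :=
    (curlCLM.continuous.tendsto _).comp hDc
  have hfrob : Continuous fun L : EuclideanSpace ℝ (Fin 3) →L[ℝ] EuclideanSpace ℝ (Fin 3) => frobeniusNormSq L := by
    unfold frobeniusNormSq
    exact continuous_finsetSum _ fun i _ =>
      ((ContinuousLinearMap.apply ℝ (EuclideanSpace ℝ (Fin 3))
        (stdOrthonormalBasis ℝ (EuclideanSpace ℝ (Fin 3)) i)).continuous.norm.pow 2)
  have hqc : ContinuousWithinAt (fun s => qDensity u s x) (Ico 0 T) t := by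
    have : (fun s => qDensity u s x) = fun s => ‖curl (u s) x‖ ^ 2 - frobeniusNormSq (fderiv ℝ (u s) x) :=
      funext fun s => qDensity_eq_norm_curl_sq_sub u s x
    rw [this]
    exact (hcurlc.norm.pow 2).sub ((hfrob.tendsto _).comp hDc)
  have hGc : ContinuousWithinAt G (Ico 0 T) t := hqc.sub hΔc
  have hT : (0 : ℝ) < T := ht.1.trans_lt ht.2
  have htcl : t ∈ closure (Ioo (0 : ℝ) T) := by
    rw [closure_Ioo hT.ne]
    exact ⟨ht.1, ht.2.le⟩
  have hGc' : ContinuousWithinAt G (Ioo 0 T) t := hGc.mono Ioo_subset_Ico_self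
  have hlim0 : Tendsto G (𝓝[Ioo 0 T] t) (𝓝 0) := by
    refine (tendsto_const_nhds (x := (0 : ℝ))).congr' ?_
    filter_upwards [self_mem_nhdsWithin] with s hs
    rw [hG]
    simp only [qDensity_eq_laplacian_pressure_of_mem_Ioo hsol hs x, sub_self]
  haveI : (𝓝[Ioo (0 : ℝ) T] t).NeBot := mem_closure_iff_nhdsWithin_neBot.1 htcl
  have hGt : G t = 0 := tendsto_nhds_unique hGc' hlim0
  exact sub_eq_zero.1 hGt

/-- Functional form: `qDensity u t = Δ (p t)` on `[0,T)`. -/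
theorem qDensity_eq_laplacian_pressure_fun {ν T : ℝ}
    {u : ℝ → (EuclideanSpace ℝ (Fin 3)) → (EuclideanSpace ℝ (Fin 3))} {p : ℝ → (EuclideanSpace ℝ (Fin 3)) → ℝ}
    (hsol : IsClassicalNSSolutionOn (Ico 0 T) ν 0 u p) {t : ℝ} (ht : t ∈ Ico 0 T) :
    qDensity u t = fun y => Δ (p t) y :=
  funext fun y => qDensity_eq_laplacian_pressure hsol ht y

end Summit.NavierStokesRegularity.NavierStokesRegularity.Theorems.StrainDoors

end
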